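import Summits.BirchSwinnertonDyer.BirchSwinnertonDyer.Theorems.BiquadraticEisensteinDescentHeegnerTwistCouplingInSupplyHeavySparseDoor
import Summits.BirchSwinnertonDyer.BirchSwinnertonDyer.Theorems.BiquadraticEisensteinDescentHeegnerTwistCouplingInSupplyHeegnerSplitDensity
import Summits.BirchSwinnertonDyer.BirchSwinnertonDyer.Theorems.BiquadraticEisensteinDescentDisjointDivisibilityResidues
import HarnessLib

set_option linter.dupNamespace false -- `Summit.BirchSwinnertonDyer.BirchSwinnertonDyer.Theorems.…` (summit = sub, D-0017)
set_option autoImplicit false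

/-!
# Crux `HeegnerTwistCouplingInSupply` (stmt-BirchSwinnertonDyer-21381), card `heavy-discriminant-sparsity` —
# §E the RELATIVE density door: a proportion `δ` of the Heegner family `A_{N₀p²}(A·p²)` non-vanishing ⟹ the crux's conclusion
# (the family has `≥ A·p²/(120N₀)` members for `A ≥ (200N₀)²`, UNIFORMLY in the odd prime `p ∤ N₀` — no new counting: w4 g24's
# effective Heegner-split counts at the height `Y = A·p²`)

Route `BiquadraticEisensteinDescent` (cell `pub/bsd-wall`; width seat `bsd-wall-cm-bed-w4` g29; THEOREMS ONLY,
`--supports 21381`). Fifth file of the unit «HEAVY-DISCRIMINANT SPARSITY + DENSITY DOOR». The density door (§C,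
`cruxConclusion_of_window_density`) is stated in ABSOLUTE currency (`≥ δ·A·p²` non-vanishing Heegner `d` in `[−A·p², −1]`);
the card's `PropNVAtScale` and every printed non-vanishing theorem for quadratic twists are RELATIVE (a proportion of the
family). The bridge is a lower bound for the family, uniform in `p`: the tree's effective counts of the crux idea
`disjoint-divisibility-pigeonhole` (w4 g24; `DisjointDivisibility.ambient N Y` = the Heegner discriminants `d ∈ [−Y, −5]` of level
`N`; `card_ambient_mul_sq_ge_odd`: `#A_{N₀p²}(Y) ≥ g_p·((3/5)(Y−4)/(8N₀p) − 5√Y)` with `g_p ≥ g·(p−1)/2 ≥ (p−1)/2` good classes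
modulo `8N₀p`, from the EFFECTIVE square-free count in a coprime class `abs_card_squarefree_modEq_sub_le`) were used there at the
height `Y = (N₀p²)^{10}`; here they are read at `Y = A·p²`, where the main term `3Ap/(40N₀)` beats the error `5√A·p` as soon as
`√A ≥ 200N₀`.

* `one_mem_admissible` — the class `c = 1` is admissible modulo `8N₀` (so `g ≥ 1`);
* ★ `card_ambient_window_ge` — for `N₀ ≥ 1`, an odd prime `p ∤ N₀` and `A ≥ (200N₀)²`: `#A_{N₀p²}(A·p²) ≥ A·p²/(120N₀)`;
* `card_nonvanishingIn_le_card_window` — `nonvanishingIn W N_W Y` (g24 currency) sits inside §C's non-vanishing finset;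
* ★★ `cruxConclusion_of_relative_window_density` — THE RELATIVE DOOR: for `N₀ ≥ 1`, `A ≥ (200N₀)²`, `δ > 0` there is `p₂` such
  that for every `W/ℚ` of conductor `N₀p²`, `p` an odd prime, `p ∤ N₀`, `p ≥ p₂`: if at least the proportion `δ` of `A_{N_W}(A·p²)`
  has `L(W^{(d)}, 1) ≠ 0` (`δ·#ambient ≤ #nonvanishingIn`), then the conclusion of `HeegnerTwistCouplingInSupply` holds at `(W, p)`.

HONEST FRAMING: a door; its input (positive-PROPORTION non-vanishing of the Heegner twists in the window `A·p²`, uniformly on a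
conductor-`N₀p²` class — the card's `PropNVAtScale` in relative form) is OPEN; `p₂` ineffective; constants `200`, `120` crude.
C⁺, the registered stubs of 21381, crux 21381 and BSD are NOT proved by any of this. [cite: Cox2013, §3.B Thm. 3.15]
-/

noncomputable section

open scoped Classical
open Finset
open WeierstrassCurve
open Literature.NumberTheory.EllipticCurves
open Summit.BirchSwinnertonDyer.BirchSwinnertonDyer.Theorems.DisjointDivisibility

namespace Summit.BirchSwinnertonDyer.BirchSwinnertonDyer.Theorems.HeavyDiscriminant

/-! ## §E.1 The Heegner family of level `N₀p²` in the window `[−A·p², −5]`, uniformly in `p` -/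

/-- **The class `c = 1` is admissible modulo `8N₀`** (`1 ≡ 1 (mod 8)`, `(1/q) = 1` for every odd prime `q ∣ N₀`), so the number
`g` of admissible classes is `≥ 1`. [folklore] -/
theorem one_mem_admissible {N₀ : ℕ} (hN₀ : 0 < N₀) :
    1 ∈ (range (8 * N₀)).filter (fun c : ℕ => c % 8 = 1 ∧
      ∀ q : ℕ, q.Prime → q ∣ N₀ → q ≠ 2 → jacobiSym (c : ℤ) q = 1) := by
  rw [mem_filter, mem_range]
  refine ⟨by omega, rfl, fun q _ _ _ => ?_⟩
  exact_mod_cast jacobiSym.one_left q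

/-- ★ **The Heegner family is large in the window, uniformly in `p`.** For `N₀ ≥ 1`, an odd prime `p ∤ N₀` and `A ≥ (200N₀)²`:
`#A_{N₀p²}(A·p²) ≥ A·p²/(120N₀)` (`A_N(Y)` = `DisjointDivisibility.ambient N Y`, the `d ∈ [−Y,−5]` that are discriminants of
imaginary quadratic Heegner fields of level `N`). Proof: at least `(p−1)/2` good classes modulo `8N₀p`
(`card_mul_half_le_card_filter_split`, `one_mem_admissible`), each carrying `≥ (3/5)(Ap²−4)/(8N₀p) − 5√A·p ≥ Ap/(40N₀)` square-free
members (`card_ambient_mul_sq_ge_odd`, i.e. the tree's effective `abs_card_squarefree_modEq_sub_le`). [folklore] -/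
theorem card_ambient_window_ge {N₀ p A : ℕ} (hN₀ : 0 < N₀) (hp : p.Prime) (hp2 : p ≠ 2) (hpN : ¬ p ∣ N₀)
    (hA : (200 * N₀) ^ 2 ≤ A) :
    ((A * p ^ 2 : ℕ) : ℝ) / (120 * N₀) ≤ ((ambient (N₀ * p ^ 2) (A * p ^ 2)).card : ℝ) := by
  have hp3 : 3 ≤ p := by
    have := hp.two_le
    omega
  have hA1 : 1 ≤ A := le_trans (Nat.one_le_pow _ _ (by omega)) hA
  have hY4 : 4 ≤ A * p ^ 2 := by nlinarith
  -- the two tree counts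
  have hlow := card_ambient_mul_sq_ge_odd (N₀ := N₀) (p := p) (Y := A * p ^ 2) hN₀ hp hp2 hY4
  have hcls := card_mul_half_le_card_filter_split hN₀ hp hp2 hpN
  have hg : 1 ≤ ((range (8 * N₀)).filter (fun c : ℕ => c % 8 = 1 ∧
      ∀ q : ℕ, q.Prime → q ∣ N₀ → q ≠ 2 → jacobiSym (c : ℤ) q = 1)).card :=
    card_pos.mpr ⟨1, one_mem_admissible hN₀⟩
  set gp := ((range (8 * N₀ * p)).filter (fun c : ℕ => c % 8 = 1 ∧
      (∀ q : ℕ, q.Prime → q ∣ N₀ → q ≠ 2 → jacobiSym (c : ℤ) q = 1) ∧ jacobiSym (c : ℤ) p = 1)).card with hgp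
  have hgp' : (p - 1) / 2 ≤ gp := le_trans (by simpa using Nat.mul_le_mul_right ((p - 1) / 2) hg) hcls
  -- real-number bookkeeping
  have hpR : (3 : ℝ) ≤ p := by exact_mod_cast hp3
  have hN₀R : (1 : ℝ) ≤ N₀ := by exact_mod_cast hN₀
  have hAR : ((200 * N₀ : ℕ) : ℝ) ^ 2 ≤ A := by exact_mod_cast hA
  push_cast at hAR
  have hsqA : 200 * (N₀ : ℝ) ≤ Real.sqrt A := by
    rw [Real.le_sqrt (by positivity) (by positivity)]
    nlinarith
  have hsqY : Real.sqrt ((A * p ^ 2 : ℕ) : ℝ) = Real.sqrt A * p := by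
    push_cast
    rw [Real.sqrt_mul (Nat.cast_nonneg _), Real.sqrt_sq (by positivity)]
  have hgpR : ((p : ℝ) - 1) / 2 ≤ (gp : ℝ) := by
    have h1 : (((p - 1) / 2 : ℕ) : ℝ) ≤ gp := by exact_mod_cast hgp'
    have hodd : (p - 1) / 2 * 2 = p - 1 := by
      have := hp.eq_one_or_self_of_dvd 2
      omega
    have h2 : (((p - 1) / 2 : ℕ) : ℝ) = ((p : ℝ) - 1) / 2 := by
      have h3 : (((p - 1) / 2 : ℕ) : ℝ) * 2 = (p : ℝ) - 1 := by
        have : (((p - 1) / 2 * 2 : ℕ) : ℝ) = ((p - 1 : ℕ) : ℝ) := by rw [hodd]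
        push_cast at this
        rw [Nat.cast_sub hp.one_le] at this
        exact_mod_cast this
      linarith
    linarith
  -- the bracket `B = (3/5)(Y−4)/(8N₀p) − 5√Y` is ≥ A p/(40 N₀)
  have hcastL : ((8 * N₀ * p : ℕ) : ℝ) = 8 * N₀ * p := by push_cast; ring
  rw [hcastL, hsqY] at hlow
  have hsqA0 : (0 : ℝ) ≤ Real.sqrt A := Real.sqrt_nonneg _
  have hAsq : (A : ℝ) = Real.sqrt A * Real.sqrt A := (Real.mul_self_sqrt (by positivity)).symm
  have hB : (A : ℝ) * p / (40 * N₀) ≤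
      (3 : ℝ) / 5 * ((((A * p ^ 2 : ℕ) : ℝ) - 4) / (8 * N₀ * p)) - 5 * (Real.sqrt A * p) := by
    push_cast
    rw [div_le_iff₀ (by positivity)]
    have h1 : (3 : ℝ) / 5 * (((A : ℝ) * (p : ℝ) ^ 2 - 4) / (8 * N₀ * p)) * (40 * N₀) = 3 * (A * p ^ 2 - 4) / p := by
      field_simp
      ring
    rw [sub_mul, h1]
    rw [show (3 : ℝ) * (A * p ^ 2 - 4) / p = 3 * A * p - 12 / p by field_simp; ring]
    have h12 : (12 : ℝ) / p ≤ 4 := by rw [div_le_iff₀ (by positivity)]; linarith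
    -- need: A p ≤ 3 A p − 12/p − 200 N₀ √A p, i.e. 200 N₀ √A p + 12/p ≤ 2 A p
    have hkey : 200 * (N₀ : ℝ) * Real.sqrt A * p ≤ A * p := by
      have h := mul_le_mul_of_nonneg_right hsqA hsqA0
      rw [← hAsq] at h
      exact mul_le_mul_of_nonneg_right h (by positivity)
    nlinarith
  -- combine: #ambient ≥ gp · B ≥ ((p−1)/2) · (A p/(40N₀)) ≥ A p²/(120 N₀)
  have hBpos : (0 : ℝ) ≤ (3 : ℝ) / 5 * ((((A * p ^ 2 : ℕ) : ℝ) - 4) / (8 * N₀ * p)) - 5 * (Real.sqrt A * p) :=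
    le_trans (by positivity) hB
  calc ((A * p ^ 2 : ℕ) : ℝ) / (120 * N₀)
      ≤ (((p : ℝ) - 1) / 2) * ((A : ℝ) * p / (40 * N₀)) := by
        push_cast
        rw [div_le_iff₀ (by positivity)]
        have : ((p : ℝ) - 1) / 2 * ((A : ℝ) * p / (40 * N₀)) * (120 * N₀) = 3 / 2 * (p - 1) * (A * p) := by
          field_simp
          ring
        rw [this]
        have hAp : (0 : ℝ) ≤ (A : ℝ) * p := by positivity
        have h32 : (p : ℝ) ≤ 3 / 2 * (p - 1) := by linarith
        calc (A : ℝ) * (p : ℝ) ^ 2 = (A * p) * p := by ring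
          _ ≤ (A * p) * (3 / 2 * (p - 1)) := mul_le_mul_of_nonneg_left h32 hAp
          _ = 3 / 2 * (p - 1) * (A * p) := by ring
    _ ≤ (gp : ℝ) * ((3 : ℝ) / 5 * ((((A * p ^ 2 : ℕ) : ℝ) - 4) / (8 * N₀ * p)) - 5 * (Real.sqrt A * p)) :=
        mul_le_mul hgpR hB (by positivity) (Nat.cast_nonneg _)
    _ ≤ ((ambient (N₀ * p ^ 2) (A * p ^ 2)).card : ℝ) := hlow

/-! ## §E.2 The relative door -/

/-- **g24's non-vanishing finset sits inside §C's.** For `N = N_W`: `nonvanishingIn W N Y ⊆` the `d ∈ [−Y, −1]` that are discriminants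
of imaginary quadratic Heegner fields of `N_W` with `|d| > 4` and `L(W^{(d)}, 1) ≠ 0`. [folklore] -/
theorem card_nonvanishingIn_le_card_window (W : WeierstrassCurve ℚ) [W.IsElliptic] (Y : ℕ) :
    (nonvanishingIn W (W.conductorNorm ℤ) Y).card ≤
      ((Icc (-(Y : ℤ)) (-1)).filter (fun d ↦
        ∃ (K : Type) (_ : Field K) (_ : NumberField K), IsImaginaryQuadratic K ∧ NumberField.discr K = d ∧
          4 < d.natAbs ∧ SatisfiesHeegnerHypothesis (W.conductorNorm ℤ) K ∧
          (W.quadraticTwist (d : ℚ)).entireLFunction 1 ≠ 0)).card := by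
  refine card_le_card (fun d hd ↦ ?_)
  rw [nonvanishingIn, mem_filter, ambient, mem_filter, mem_Icc] at hd
  obtain ⟨⟨⟨hdY, hd5⟩, K, iF, iN, hK, hdisc, h4, hH⟩, hL⟩ := hd
  rw [mem_filter, mem_Icc]
  exact ⟨⟨hdY, by omega⟩, K, iF, iN, hK, hdisc, h4, hH, hL⟩

/-- ★★ **THE RELATIVE DENSITY DOOR.** For `N₀ ≥ 1`, `A ≥ (200N₀)²` and `δ > 0` there is `p₂` such that for every elliptic curve
`W/ℚ` and every odd prime `p ∤ N₀`, `p ≥ p₂`, with `N_W = N₀·p²`: if at least the proportion `δ` of the Heegner family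
`A_{N_W}(A·p²)` (imaginary quadratic Heegner fields of `N_W` with `4 < |d| ≤ A·p²`) has `L(W^{(d)}, 1) ≠ 0`, then there is an imaginary
quadratic Heegner field `K′` of `N_W` with `|d_{K′}| > 4`, `L(W^{(d_{K′})}, 1) ≠ 0` and `p ∤ h(K′)` — the conclusion of
`HeegnerTwistCouplingInSupply` at `(W, p)`. Proof: `card_ambient_window_ge` makes the relative count absolute with `δ/(120N₀)`;
then `cruxConclusion_of_window_density`. [cite: Cox2013, §3.B Thm. 3.15] -/
theorem cruxConclusion_of_relative_window_density (N₀ A : ℕ) (δ : ℝ) (hN₀ : 0 < N₀) (hA : (200 * N₀) ^ 2 ≤ A)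
    (hδ : 0 < δ) :
    ∃ p₂ : ℕ, ∀ (W : WeierstrassCurve ℚ) [W.IsElliptic] (p : ℕ), p.Prime → p ≠ 2 → ¬ p ∣ N₀ → p₂ ≤ p →
      W.conductorNorm ℤ = N₀ * p ^ 2 →
      δ * ((ambient (W.conductorNorm ℤ) (A * p ^ 2)).card : ℝ) ≤
        ((nonvanishingIn W (W.conductorNorm ℤ) (A * p ^ 2)).card : ℝ) →
      ∃ (K : Type) (_ : Field K) (_ : NumberField K),
        IsImaginaryQuadratic K ∧ 4 < (NumberField.discr K).natAbs ∧
          SatisfiesHeegnerHypothesis (W.conductorNorm ℤ) K ∧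
          (W.quadraticTwist (NumberField.discr K : ℚ)).entireLFunction 1 ≠ 0 ∧ ¬ p ∣ NumberField.classNumber K := by
  have hA1 : 1 ≤ A := le_trans (Nat.one_le_pow _ _ (by omega)) hA
  have hδ' : 0 < δ / (120 * N₀) := by positivity
  obtain ⟨p₂, hp₂⟩ := cruxConclusion_of_window_density A (δ / (120 * N₀)) hA1 hδ'
  refine ⟨p₂, fun W _ p hp hp2 hpN hle hN hrel ↦ hp₂ W p hp hp2 hle ?_⟩
  have hfam := card_ambient_window_ge hN₀ hp hp2 hpN hA
  rw [← hN] at hfam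
  have hsub : ((nonvanishingIn W (W.conductorNorm ℤ) (A * p ^ 2)).card : ℝ) ≤
      (((Icc (-((A * p ^ 2 : ℕ) : ℤ)) (-1)).filter (fun d ↦
        ∃ (K : Type) (_ : Field K) (_ : NumberField K), IsImaginaryQuadratic K ∧ NumberField.discr K = d ∧
          4 < d.natAbs ∧ SatisfiesHeegnerHypothesis (W.conductorNorm ℤ) K ∧
          (W.quadraticTwist (d : ℚ)).entireLFunction 1 ≠ 0)).card : ℝ) := by
    exact_mod_cast card_nonvanishingIn_le_card_window W (A * p ^ 2)
  have hN₀R : (0 : ℝ) < 120 * N₀ := by positivity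
  calc δ / (120 * N₀) * ((A * p ^ 2 : ℕ) : ℝ) = δ * (((A * p ^ 2 : ℕ) : ℝ) / (120 * N₀)) := by ring
    _ ≤ δ * ((ambient (W.conductorNorm ℤ) (A * p ^ 2)).card : ℝ) := by gcongr
    _ ≤ _ := hrel.trans hsub

/-! ## §E.3 The card's `HeavySparse` in its own (relative) currency (appended) -/

/-- ★ **HEAVY SPARSITY RELATIVE TO THE HEEGNER FAMILY** (the card's research lemma `HeavySparse` as written — «heavy Heegner
discriminants of level `N₀p²` with `|d| ≤ A·p²` are at most an `η`-fraction of all Heegner discriminants of that level in that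
window» — for `A ≥ (200N₀)²` and odd primes `p ∤ N₀`): from the absolute `heavySparse_window` (with `η/(120N₀)`) and the uniform
family bound `card_ambient_window_ge`. The heavy set here is even counted WITHOUT its Heegner conjunct (a superset). [cite: Cox2013, §3.B Thm. 3.15] -/
theorem heavySparse_relative (N₀ A : ℕ) (η : ℝ) (hN₀ : 0 < N₀) (hA : (200 * N₀) ^ 2 ≤ A) (hη : 0 < η) :
    ∃ p₀ : ℕ, ∀ p : ℕ, p.Prime → p ≠ 2 → ¬ p ∣ N₀ → p₀ ≤ p →
      ((((Icc (-((A * p ^ 2 : ℕ) : ℤ)) (-1)).filter (fun d ↦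
        ∃ (K : Type) (_ : Field K) (_ : NumberField K), IsImaginaryQuadratic K ∧ NumberField.discr K = d ∧
          2 ^ (d.natAbs.primeFactors.card - 1) * p ≤ NumberField.classNumber K)).card : ℕ) : ℝ) ≤
        η * ((ambient (N₀ * p ^ 2) (A * p ^ 2)).card : ℝ) := by
  have hA1 : 1 ≤ A := le_trans (Nat.one_le_pow _ _ (by omega)) hA
  obtain ⟨p₀, hp₀⟩ := heavySparse_window A (η / (120 * N₀)) hA1 (by positivity)
  refine ⟨p₀, fun p hp hp2 hpN hle ↦ (hp₀ p hle).trans ?_⟩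
  have hfam := card_ambient_window_ge hN₀ hp hp2 hpN hA
  calc η / (120 * N₀) * ((A * p ^ 2 : ℕ) : ℝ) = η * (((A * p ^ 2 : ℕ) : ℝ) / (120 * N₀)) := by ring
    _ ≤ η * ((ambient (N₀ * p ^ 2) (A * p ^ 2)).card : ℝ) := by gcongr

end Summit.BirchSwinnertonDyer.BirchSwinnertonDyer.Theorems.HeavyDiscriminant

end
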